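import Summits.NavierStokesRegularity.NavierStokesRegularity.Theorems.ScalingDefectPeepholeDoorSlicePressureDual

/-!
# ScalingDefectPeepholeDoorSlicePressure — door S30 «ScalingDefectPeepholeDoor», plate P2 (K1ω) input hP, part 2:
# the `q = 4` SLICE PRESSURE BOUND and `scaledSlicePressure_holds` (ns-s29-p2 g2; carve of ns-s30-p1 g0, 2026-08-28T09:04:54Z)

* `exists_forall_lintegral_ball_pressure_sq_le` — for the Pineau–Vicol class (classical on `[−1,0) × B₁`, annular pressure bound
  (1.16)): `∫_{B_{1/32}} |p(t)|² ≤ C₁ ∫_{B_{3/4}} |u(t)|⁴ + C₂(C_p)` for every `−1 < t < 0` (the exponent-2 twin of the tree's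
  `exists_forall_lintegral_ball_pressure_rpow_le`; dual estimate of part 1 at radii `(9/16, 11/16, 1/32, 3/4)`, CZ at `p = 2`).
* `lintegral_ball_typeI_four_le` — Type I (1.15) gives `∫_{B_{3/4}} |u(t)|⁴ ≤ 4 |B₁| C_u⁴ / √(−t)` (split at `|x| = √(−t)`; the shell
  integral `∫_{|x| ≥ a} |x|⁻⁴ = 3|B₁|/a` is the tree's `lintegral_compl_ball_norm_rpow_neg`).
* `scaledSlicePressure_holds` — **hP**: `∀ C_u > 0, ∀ R > 0, ∃ C_P ≥ 0, ∀ C_p > 0, ∃ T_P > 0`, for every solution of the class and every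
  `t ∈ (−T_P, 0)`, `‖p(t)‖_{L²(B(0, R√(−t)))} ≤ C_P (−t)^{−1/4}` (`C_P² = 4|B₁|C₁C_u⁴ + 1` is independent of `C_p`; the constant
  `C₂(C_p)` is absorbed by lateness, `T_P ≤ (C₂+1)⁻²`, and `B(0,R√(−t)) ⊆ B_{1/32}` for `T_P ≤ (32R)⁻²`).

With hP, ns-s30-p1's `vortexDefectTubeBound_of_scaledSlicePressure` closes K1ω and the door S30.  Door S30 is a regularity CRITERION
(item 0056 `NoTypeII` stays OPEN); nothing here bears on NS regularity itself.
-/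

noncomputable section

set_option linter.dupNamespace false

namespace Summit.NavierStokesRegularity.NavierStokesRegularity.Theorems.ScalingDefectPeepholeDoor

open MeasureTheory Set Function Filter Metric TopologicalSpace
open scoped ENNReal NNReal InnerProductSpace RealInnerProductSpace Laplacian Topology
open Literature.Analysis Literature.Analysis.FluidPDE

-- nested operator types
set_option maxSynthPendingDepth 3

/-! ## §1 The slice bound `∫_{B_{1/32}} |p(t)|² ≤ C₁ ∫_{B_{3/4}} |u(t)|⁴ + C₂` -/

/-- `(a X^{1/2} + b)² ≤ 2 a² X + 2 b²` in `ℝ≥0∞`. -/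
theorem ofReal_rpow_two_le (a b : ℝ) (ha : 0 ≤ a) (hb : 0 ≤ b) {X : ℝ≥0∞} (hX : X ≠ ⊤) :
    ENNReal.ofReal ((a * (X ^ (1 / 2 : ℝ)).toReal + b) ^ (2 : ℝ)) ≤
      2 * (ENNReal.ofReal a) ^ (2 : ℝ) * X + 2 * (ENNReal.ofReal b) ^ (2 : ℝ) := by
  have hX12 : X ^ (1 / 2 : ℝ) ≠ ⊤ := ENNReal.rpow_ne_top_of_nonneg (by norm_num) hX
  have h0 : 0 ≤ a * (X ^ (1 / 2 : ℝ)).toReal := by positivity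
  rw [← ENNReal.ofReal_rpow_of_nonneg (by positivity) (by norm_num), ENNReal.ofReal_add h0 hb,
    ENNReal.ofReal_mul ha, ENNReal.ofReal_toReal hX12]
  have hconv := ENNReal.rpow_add_le_mul_rpow_add_rpow (ENNReal.ofReal a * X ^ (1 / 2 : ℝ))
    (ENNReal.ofReal b) (by norm_num : (1 : ℝ) ≤ 2)
  rw [show (2 : ℝ) - 1 = 1 by norm_num, ENNReal.rpow_one] at hconv
  refine hconv.trans (le_of_eq ?_)
  rw [ENNReal.mul_rpow_of_nonneg _ _ (by norm_num : (0 : ℝ) ≤ 2), ← ENNReal.rpow_mul,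
    show (1 / 2 : ℝ) * 2 = 1 by norm_num, ENNReal.rpow_one]
  ring

/-- **The `q = 4` slice pressure bound for the solutions of Theorem 1.9** (exponent-2 twin of
`exists_forall_lintegral_ball_pressure_rpow_le`): `∫_{B_{1/32}} |p(t)|² ≤ C₁ ∫_{B_{3/4}} |u(t)|⁴ + C₂(C_p)` for `−1 < t < 0`. -/
theorem exists_forall_lintegral_ball_pressure_sq_le :
    ∃ C₁ : ℝ≥0, ∀ Cp : ℝ, ∃ C₂ : ℝ≥0, ∀ (u : ℝ → (EuclideanSpace ℝ (Fin 3)) → (EuclideanSpace ℝ (Fin 3))) (p : ℝ → (EuclideanSpace ℝ (Fin 3)) → ℝ),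
      IsClassicalNSSolutionOnRegion (Ico (-1 : ℝ) 0 ×ˢ ball (0 : (EuclideanSpace ℝ (Fin 3))) 1) 1 0 u p →
      (∀ t ∈ Ico (-1 : ℝ) 0, ∀ x : (EuclideanSpace ℝ (Fin 3)), 1 / 2 < ‖x‖ → ‖x‖ < 3 / 4 → |p t x| ≤ Cp) →
      ∀ t ∈ Ioo (-1 : ℝ) 0,
        ∫⁻ x in ball (0 : (EuclideanSpace ℝ (Fin 3))) (1 / 32), ‖p t x‖ₑ ^ (2 : ℝ) ≤
          C₁ * (∫⁻ x in ball (0 : (EuclideanSpace ℝ (Fin 3))) (3 / 4), ‖u t x‖ₑ ^ (4 : ℕ)) + C₂ := by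
  have h₀ : (0 : ℝ) < 9 / 16 := by norm_num
  have h₁ : (9 / 16 : ℝ) < 11 / 16 := by norm_num
  have hR : (1 / 32 : ℝ) + 11 / 16 < 3 / 4 := by norm_num
  obtain ⟨A, hA⟩ := stein1970_hessian_Lp_bound_holds_fin3.hessian_newtonNearPotential
    (p := 2) (by norm_num) (by simp)
  have hlam : ∫⁻ z, ‖newtonFarLaplacian (9 / 16) (11 / 16) z‖ₑ < ⊤ :=
    (integrable_newtonFarLaplacian h₀ h₁).2
  set A' : ℝ≥0 := A * (1 + (∫⁻ z, ‖newtonFarLaplacian (9 / 16) (11 / 16) z‖ₑ).toNNReal) with hA'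
  have hA'' : ∀ ⦃g : (EuclideanSpace ℝ (Fin 3)) → ℝ⦄, ContDiff ℝ 2 g → HasCompactSupport g → ∀ a b : (EuclideanSpace ℝ (Fin 3)), ‖a‖ ≤ 1 →
      ‖b‖ ≤ 1 →
      eLpNorm (fun x => fderiv ℝ (fun y => fderiv ℝ (newtonNearPotential (9 / 16) (11 / 16) g) y a)
        x b) 2 volume ≤ A' * eLpNorm g 2 volume := by
    intro g hg hgc a b ha hb
    refine (hA h₀ h₁ hg hgc a b ha hb).trans (le_of_eq ?_)
    rw [hA', ENNReal.coe_mul, ENNReal.coe_add, ENNReal.coe_one, ENNReal.coe_toNNReal hlam.ne,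
      mul_assoc]
  obtain ⟨CΛ, hCΛ0, hCΛ⟩ := exists_abs_integral_mul_newtonFarSmoothing_le_two h₀ h₁ (1 / 32 : ℝ)
  set a : ℝ := 9 * A' with ha_def
  have ha0 : 0 ≤ a := by positivity
  set C₁ : ℝ≥0∞ := 2 * (ENNReal.ofReal a) ^ (2 : ℝ) with hC₁
  have hC₁top : C₁ ≠ ⊤ :=
    ENNReal.mul_ne_top (by simp) (ENNReal.rpow_ne_top_of_nonneg (by norm_num) ENNReal.ofReal_ne_top)
  refine ⟨C₁.toNNReal, fun Cp => ?_⟩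
  set b : ℝ := Cp * CΛ with hb_def
  set C₂ : ℝ≥0∞ := 2 * (ENNReal.ofReal b) ^ (2 : ℝ) with hC₂
  have hC₂top : C₂ ≠ ⊤ :=
    ENNReal.mul_ne_top (by simp) (ENNReal.rpow_ne_top_of_nonneg (by norm_num) ENNReal.ofReal_ne_top)
  refine ⟨C₂.toNNReal, fun u p hreg hP t ht => ?_⟩
  rw [ENNReal.coe_toNNReal hC₁top, ENNReal.coe_toNNReal hC₂top]
  have hCp : 0 ≤ Cp := pineauVicol_annulusConst_nonneg hP
  have hb0 : 0 ≤ b := by positivity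
  have htI : t ∈ Ico (-1 : ℝ) 0 := Ioo_subset_Ico_self ht
  have hsec : spaceSection (Ico (-1 : ℝ) 0 ×ˢ ball (0 : (EuclideanSpace ℝ (Fin 3))) 1) t = ball 0 1 :=
    spaceSection_prod htI _
  have hu := hreg.contDiffOn_velocity t
  have hp := hreg.contDiffOn_pressure t
  rw [hsec] at hu hp
  have hsub : closedBall (0 : (EuclideanSpace ℝ (Fin 3))) (3 / 4) ⊆ ball 0 1 := closedBall_subset_ball (by norm_num)
  have huc : ContinuousOn (u t) (closedBall 0 (3 / 4)) := hu.continuousOn.mono hsub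
  have hpc : ContinuousOn (p t) (closedBall 0 (3 / 4)) := hp.continuousOn.mono hsub
  have hv : AEStronglyMeasurable (u t) (volume.restrict (ball (0 : (EuclideanSpace ℝ (Fin 3))) (3 / 4))) :=
    (huc.mono ball_subset_closedBall).aestronglyMeasurable measurableSet_ball
  set X : ℝ≥0∞ := ∫⁻ x in ball (0 : (EuclideanSpace ℝ (Fin 3))) (3 / 4), ‖u t x‖ₑ ^ (4 : ℕ) with hX_def
  have hX : X ≠ ⊤ := by
    obtain ⟨M, hM⟩ := (isCompact_closedBall (0 : (EuclideanSpace ℝ (Fin 3))) (3 / 4)).exists_bound_of_continuousOn huc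
    have hle : X ≤ ∫⁻ _ in ball (0 : (EuclideanSpace ℝ (Fin 3))) (3 / 4), ENNReal.ofReal M ^ (4 : ℕ) := by
      refine setLIntegral_mono' measurableSet_ball fun x hx => ?_
      gcongr
      rw [← ofReal_norm]
      exact ENNReal.ofReal_le_ofReal (hM x (ball_subset_closedBall hx))
    refine ne_top_of_le_ne_top ?_ hle
    rw [setLIntegral_const]
    exact ENNReal.mul_ne_top (ENNReal.pow_ne_top ENNReal.ofReal_ne_top) measure_ball_lt_top.ne
  have hπ : IntegrableOn (p t) (ball (0 : (EuclideanSpace ℝ (Fin 3))) (3 / 4)) volume :=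
    (hpc.integrableOn_compact (isCompact_closedBall _ _)).mono_set ball_subset_closedBall
  have hπb : ∀ x : (EuclideanSpace ℝ (Fin 3)), 9 / 16 - 1 / 32 < ‖x‖ → ‖x‖ < 11 / 16 + 1 / 32 → |p t x| ≤ Cp :=
    fun x hx1 hx2 => hP t htI x (by linarith) (by linarith)
  have hO : IsOpen (Ioo (-1 : ℝ) 0 ×ˢ ball (0 : (EuclideanSpace ℝ (Fin 3))) 1) := isOpen_Ioo.prod isOpen_ball
  have hreg' := hreg.mono_of_isOpen (prod_mono Ioo_subset_Ico_self Subset.rfl) hO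
  have hid : ∀ ψ : (EuclideanSpace ℝ (Fin 3)) → ℝ, ContDiff ℝ (⊤ : ℕ∞) ψ → HasCompactSupport ψ →
      tsupport ψ ⊆ ball (0 : (EuclideanSpace ℝ (Fin 3))) (3 / 4) →
        ∫ x, p t x * Δ ψ x = -∫ x, fderiv ℝ (fderiv ℝ ψ) x (u t x) (u t x) :=
    fun ψ hψ hψc hψs => integral_pressure_mul_laplacian_test hO hreg' hψ hψc fun x hx =>
      mk_mem_prod ht (ball_subset_ball (by norm_num) (hψs hx))
  set K : ℝ := a * (X ^ (1 / 2 : ℝ)).toReal + b with hK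
  have hK0 : 0 ≤ K := by positivity
  have hdual : ∀ g : (EuclideanSpace ℝ (Fin 3)) → ℝ, ContDiff ℝ (⊤ : ℕ∞) g → HasCompactSupport g →
      tsupport g ⊆ ball (0 : (EuclideanSpace ℝ (Fin 3))) (1 / 32) → |∫ x, p t x * g x| ≤ K * (eLpNorm g 2 volume).toReal := by
    intro g hg _ hgs
    have h := abs_integral_mul_test_le_of_slice_identity_two hA'' hCΛ h₀ h₁ hR hv hX hπ hCp hπb hid
      hg hgs
    rw [hK, ha_def, hb_def]
    exact h
  have hπ' : IntegrableOn (p t) (ball (0 : (EuclideanSpace ℝ (Fin 3))) (1 / 32)) volume :=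
    hπ.mono_set (ball_subset_ball (by norm_num))
  have hmain := lintegral_ball_enorm_sq_le_of_forall_test hK0 hπ' hdual
  exact hmain.trans (ofReal_rpow_two_le a b ha0 hb0 hX)

/-! ## §2 Type I: `∫_{B_{3/4}} |u(t)|⁴ ≤ 4 |B₁| C_u⁴ / √(−t)` -/

/-- **The `L⁴` slice level under Type I**: `∫_{B_{3/4}} |u(t)|⁴ ≤ 4 |B₁| C_u⁴ / √(−t)` for `−1 < t < 0` (split at `|x| = √(−t)`:
inside `(C_u/√(−t))⁴ · |B(0,√(−t))|`, outside `C_u⁴ ∫_{|x| ≥ √(−t)} |x|⁻⁴ = 3|B₁| C_u⁴/√(−t)`). -/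
theorem lintegral_ball_typeI_four_le {u : ℝ → EuclideanSpace ℝ (Fin 3) → EuclideanSpace ℝ (Fin 3)} {Cu : ℝ}
    (hI : ∀ t ∈ Ico (-1 : ℝ) 0, ∀ x ∈ ball (0 : EuclideanSpace ℝ (Fin 3)) 1, ‖u t x‖ ≤ Cu / (Real.sqrt (-t) + ‖x‖))
    {t : ℝ} (ht : t ∈ Ioo (-1 : ℝ) 0) :
    ∫⁻ x in ball (0 : EuclideanSpace ℝ (Fin 3)) (3 / 4), ‖u t x‖ₑ ^ (4 : ℕ) ≤
      ENNReal.ofReal (4 * volume.real (ball (0 : EuclideanSpace ℝ (Fin 3)) 1) * Cu ^ 4 / Real.sqrt (-t)) := by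
  set a : ℝ := Real.sqrt (-t) with ha_def
  have ha : 0 < a := Real.sqrt_pos.2 (by linarith [ht.2])
  have htI : t ∈ Ico (-1 : ℝ) 0 := Ioo_subset_Ico_self ht
  set V : ℝ := volume.real (ball (0 : EuclideanSpace ℝ (Fin 3)) 1) with hV
  have hVtop : volume (ball (0 : EuclideanSpace ℝ (Fin 3)) 1) ≠ ⊤ := measure_ball_lt_top.ne
  -- the two majorants
  set g₁ : EuclideanSpace ℝ (Fin 3) → ℝ≥0∞ := (ball (0 : EuclideanSpace ℝ (Fin 3)) a).indicator
    fun _ => ENNReal.ofReal (Cu ^ 4 / a ^ 4) with hg₁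
  set g₂ : EuclideanSpace ℝ (Fin 3) → ℝ≥0∞ := (ball (0 : EuclideanSpace ℝ (Fin 3)) a)ᶜ.indicator
    fun x => ENNReal.ofReal (Cu ^ 4) * ENNReal.ofReal (‖x‖ ^ (-(4 : ℝ))) with hg₂
  have hpt : ∀ x ∈ ball (0 : EuclideanSpace ℝ (Fin 3)) (3 / 4), ‖u t x‖ₑ ^ (4 : ℕ) ≤ g₁ x + g₂ x := by
    intro x hx
    have hx1 : x ∈ ball (0 : EuclideanSpace ℝ (Fin 3)) 1 := ball_subset_ball (by norm_num) hx
    have hux : ‖u t x‖ ≤ Cu / (a + ‖x‖) := hI t htI x hx1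
    have hpos : 0 < a + ‖x‖ := add_pos_of_pos_of_nonneg ha (norm_nonneg _)
    have hu4 : ‖u t x‖ₑ ^ (4 : ℕ) = ENNReal.ofReal (‖u t x‖ ^ 4) := by
      rw [← ofReal_norm, ENNReal.ofReal_pow (norm_nonneg _)]
    have hb4 : ‖u t x‖ ^ 4 ≤ Cu ^ 4 / (a + ‖x‖) ^ 4 := by
      rw [← div_pow]; exact pow_le_pow_left₀ (norm_nonneg _) hux 4
    by_cases hxa : x ∈ ball (0 : EuclideanSpace ℝ (Fin 3)) a
    · have hxc : x ∉ (ball (0 : EuclideanSpace ℝ (Fin 3)) a)ᶜ := fun h => h hxa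
      rw [hg₁, hg₂, indicator_of_mem hxa, indicator_of_notMem hxc, add_zero, hu4]
      refine ENNReal.ofReal_le_ofReal (hb4.trans ?_)
      exact div_le_div_of_nonneg_left (by positivity) (by positivity)
        (pow_le_pow_left₀ ha.le (le_add_of_nonneg_right (norm_nonneg _)) 4)
    · have hxa' : a ≤ ‖x‖ := by rw [mem_ball_zero_iff, not_lt] at hxa; exact hxa
      have hx0 : 0 < ‖x‖ := ha.trans_le hxa'
      rw [hg₁, hg₂, indicator_of_notMem hxa, indicator_of_mem (mem_compl hxa), zero_add, hu4,
        ← ENNReal.ofReal_mul (by positivity)]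
      refine ENNReal.ofReal_le_ofReal (hb4.trans ?_)
      rw [Real.rpow_neg (norm_nonneg _), show (4 : ℝ) = ((4 : ℕ) : ℝ) by norm_num, Real.rpow_natCast,
        ← div_eq_mul_inv]
      exact div_le_div_of_nonneg_left (by positivity) (by positivity)
        (pow_le_pow_left₀ (norm_nonneg _) (le_add_of_nonneg_left ha.le) 4)
  have hg₁m : Measurable g₁ := measurable_const.indicator measurableSet_ball
  -- the two integrals
  have hI₁ : ∫⁻ x, g₁ x = ENNReal.ofReal (V * Cu ^ 4 / a) := by
    rw [hg₁, lintegral_indicator measurableSet_ball, setLIntegral_const,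
      Measure.addHaar_ball volume (0 : EuclideanSpace ℝ (Fin 3)) ha.le, finrank_euclideanSpace_fin,
      ← ofReal_measureReal hVtop, ← hV, ← ENNReal.ofReal_mul (by positivity),
      ← ENNReal.ofReal_mul (by positivity)]
    congr 1
    field_simp
  have hI₂ : ∫⁻ x, g₂ x = ENNReal.ofReal (3 * V * Cu ^ 4 / a) := by
    rw [hg₂, lintegral_indicator measurableSet_ball.compl, lintegral_const_mul' _ _ ENNReal.ofReal_ne_top,
      lintegral_compl_ball_norm_rpow_neg (α := 4) (by norm_num) ha,
      ← ENNReal.ofReal_mul (by positivity)]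
    congr 1
    rw [threeVolBall, ← hV, show (3 : ℝ) - 4 = -1 by norm_num, Real.rpow_neg_one]
    field_simp
    norm_num
  calc ∫⁻ x in ball (0 : EuclideanSpace ℝ (Fin 3)) (3 / 4), ‖u t x‖ₑ ^ (4 : ℕ)
      ≤ ∫⁻ x in ball (0 : EuclideanSpace ℝ (Fin 3)) (3 / 4), (g₁ x + g₂ x) := setLIntegral_mono' measurableSet_ball hpt
    _ ≤ ∫⁻ x, (g₁ x + g₂ x) := lintegral_mono' Measure.restrict_le_self le_rfl
    _ = (∫⁻ x, g₁ x) + ∫⁻ x, g₂ x := lintegral_add_left hg₁m _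
    _ = ENNReal.ofReal (V * Cu ^ 4 / a) + ENNReal.ofReal (3 * V * Cu ^ 4 / a) := by rw [hI₁, hI₂]
    _ = ENNReal.ofReal (4 * V * Cu ^ 4 / a) := by
        rw [← ENNReal.ofReal_add (by positivity) (by positivity)]
        congr 1
        ring

/-! ## §3 hP: `‖p(t)‖_{L²(B(0, R√(−t)))} ≤ C_P (−t)^{−1/4}` -/

/-- **hP (ns-s30-p1's one remaining input of K1ω).**  For the Pineau–Vicol class with (1.15)–(1.16):
`∀ C_u > 0, ∀ R > 0, ∃ C_P ≥ 0, ∀ C_p > 0, ∃ T_P > 0, ∀ (u,p), ∀ t ∈ (−T_P, 0), ‖p(t)‖_{L²(B(0,R√(−t)))} ≤ C_P (−t)^{−1/4}`. -/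
theorem scaledSlicePressure_holds :
    ∀ Cu : ℝ, 0 < Cu → ∀ R : ℝ, 0 < R → ∃ C_P : ℝ, 0 ≤ C_P ∧ ∀ Cp : ℝ, 0 < Cp → ∃ T_P : ℝ, 0 < T_P ∧
      ∀ (u : ℝ → EuclideanSpace ℝ (Fin 3) → EuclideanSpace ℝ (Fin 3)) (p : ℝ → EuclideanSpace ℝ (Fin 3) → ℝ),
        IsClassicalNSSolutionOnRegion (Ico (-1 : ℝ) 0 ×ˢ ball (0 : EuclideanSpace ℝ (Fin 3)) 1) 1 0 u p →
        (∀ t ∈ Ico (-1 : ℝ) 0, ∀ x ∈ ball (0 : EuclideanSpace ℝ (Fin 3)) 1, ‖u t x‖ ≤ Cu / (Real.sqrt (-t) + ‖x‖)) →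
        (∀ t ∈ Ico (-1 : ℝ) 0, ∀ x : EuclideanSpace ℝ (Fin 3), 1 / 2 < ‖x‖ → ‖x‖ < 3 / 4 → |p t x| ≤ Cp) →
        ∀ t ∈ Ioo (-T_P) 0,
          eLpNorm (p t) 2 (volume.restrict (ball (0 : EuclideanSpace ℝ (Fin 3)) (R * Real.sqrt (-t)))) ≤
            ENNReal.ofReal (C_P * (-t) ^ (-(1 / 4 : ℝ))) := by
  intro Cu hCu R hR
  obtain ⟨C₁, hC₁⟩ := exists_forall_lintegral_ball_pressure_sq_le
  set V : ℝ := volume.real (ball (0 : EuclideanSpace ℝ (Fin 3)) 1) with hV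
  have hV0 : 0 ≤ V := measureReal_nonneg
  set D : ℝ := (C₁ : ℝ) * (4 * V * Cu ^ 4) + 1 with hD
  have hD0 : 0 < D := by positivity
  refine ⟨Real.sqrt D, Real.sqrt_nonneg _, fun Cp hCp => ?_⟩
  obtain ⟨C₂, hC₂⟩ := hC₁ Cp
  set T_P : ℝ := min (1 / 2) (min ((32 * R)⁻¹ ^ 2) (((C₂ : ℝ) + 1)⁻¹ ^ 2)) with hT_P
  have hT0 : 0 < T_P := lt_min (by norm_num) (lt_min (by positivity) (by positivity))
  have hT1 : T_P ≤ 1 / 2 := min_le_left _ _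
  have hT2 : T_P ≤ (32 * R)⁻¹ ^ 2 := (min_le_right _ _).trans (min_le_left _ _)
  have hT3 : T_P ≤ ((C₂ : ℝ) + 1)⁻¹ ^ 2 := (min_le_right _ _).trans (min_le_right _ _)
  refine ⟨T_P, hT0, fun u p hreg hI hP t ht => ?_⟩
  have ht0 : 0 < -t := by linarith [ht.2]
  have htT : -t < T_P := by linarith [ht.1]
  have ht' : t ∈ Ioo (-1 : ℝ) 0 := ⟨by linarith, ht.2⟩
  set a : ℝ := Real.sqrt (-t) with ha_def
  have ha : 0 < a := Real.sqrt_pos.2 ht0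
  have ha2 : a ^ 2 = -t := Real.sq_sqrt ht0.le
  -- `a ≤ √T_P` consequences
  have haT : a ≤ Real.sqrt T_P := Real.sqrt_le_sqrt htT.le
  have hsq1 : Real.sqrt ((32 * R)⁻¹ ^ 2) = (32 * R)⁻¹ := Real.sqrt_sq (by positivity)
  have hsq2 : Real.sqrt (((C₂ : ℝ) + 1)⁻¹ ^ 2) = ((C₂ : ℝ) + 1)⁻¹ := Real.sqrt_sq (by positivity)
  have haR : R * a ≤ 1 / 32 := by
    have h1 : a ≤ (32 * R)⁻¹ := haT.trans (hsq1 ▸ Real.sqrt_le_sqrt hT2)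
    calc R * a ≤ R * (32 * R)⁻¹ := by gcongr
      _ = 1 / 32 := by field_simp
  have haC : a ≤ ((C₂ : ℝ) + 1)⁻¹ := haT.trans (hsq2 ▸ Real.sqrt_le_sqrt hT3)
  have hC₂a : (C₂ : ℝ) ≤ 1 / a := by
    rw [le_div_iff₀ ha]
    have h1 : ((C₂ : ℝ) + 1) * a ≤ 1 := by
      calc ((C₂ : ℝ) + 1) * a ≤ ((C₂ : ℝ) + 1) * ((C₂ : ℝ) + 1)⁻¹ := by gcongr
        _ = 1 := mul_inv_cancel₀ (by positivity)
    nlinarith [C₂.coe_nonneg, ha]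
  -- the slice bound on `B(0, R a) ⊆ B_{1/32}`
  have h1 := hC₂ u p hreg hP t ht'
  have hX := lintegral_ball_typeI_four_le hI ht'
  have hmono : ∫⁻ x in ball (0 : EuclideanSpace ℝ (Fin 3)) (R * a), ‖p t x‖ₑ ^ (2 : ℝ) ≤
      ∫⁻ x in ball (0 : EuclideanSpace ℝ (Fin 3)) (1 / 32), ‖p t x‖ₑ ^ (2 : ℝ) :=
    lintegral_mono_set (ball_subset_ball haR)
  have hball : ∫⁻ x in ball (0 : EuclideanSpace ℝ (Fin 3)) (R * a), ‖p t x‖ₑ ^ (2 : ℝ) ≤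
      ENNReal.ofReal (D / a) := by
    refine hmono.trans (h1.trans ?_)
    calc (C₁ : ℝ≥0∞) * (∫⁻ x in ball (0 : EuclideanSpace ℝ (Fin 3)) (3 / 4), ‖u t x‖ₑ ^ (4 : ℕ)) + C₂
        ≤ (C₁ : ℝ≥0∞) * ENNReal.ofReal (4 * V * Cu ^ 4 / a) + ENNReal.ofReal (1 / a) := by
          refine add_le_add (mul_le_mul_right hX _) ?_
          rw [← ENNReal.ofReal_coe_nnreal]; exact ENNReal.ofReal_le_ofReal hC₂a
      _ = ENNReal.ofReal (D / a) := by
          rw [← ENNReal.ofReal_coe_nnreal, ← ENNReal.ofReal_mul C₁.coe_nonneg,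
            ← ENNReal.ofReal_add (by positivity) (by positivity)]
          congr 1
          rw [hD]
          field_simp
  -- take square roots
  rw [eLpNorm_two_eq']
  calc (∫⁻ x in ball (0 : EuclideanSpace ℝ (Fin 3)) (R * a), ‖p t x‖ₑ ^ (2 : ℝ)) ^ (1 / 2 : ℝ)
      ≤ (ENNReal.ofReal (D / a)) ^ (1 / 2 : ℝ) := by gcongr
    _ = ENNReal.ofReal (Real.sqrt D * (-t) ^ (-(1 / 4 : ℝ))) := by
        rw [ENNReal.ofReal_rpow_of_nonneg (by positivity) (by norm_num)]
        congr 1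
        rw [← Real.sqrt_eq_rpow, Real.sqrt_div' _ ha.le]
        have h4 : (-t) ^ (-(1 / 4 : ℝ)) = (Real.sqrt a)⁻¹ := by
          rw [ha_def, Real.sqrt_eq_rpow, Real.sqrt_eq_rpow, ← Real.rpow_mul ht0.le, Real.rpow_neg ht0.le]
          norm_num
        rw [h4, div_eq_mul_inv]

end Summit.NavierStokesRegularity.NavierStokesRegularity.Theorems.ScalingDefectPeepholeDoor

end
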